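import Mathlib
import HarnessLib
import Literature.Analysis.FluidPDE.ClassicalSolution
import Literature.Analysis.FluidPDE.Vorticity
import Literature.Analysis.FluidPDE.TaoEnstrophyLocalisation
import Literature.Analysis.FluidPDE.TaoMainEstimateVorticityAnnulus

/-!
# Route `QuarterLogPincer`, crux `TypeIQuantSubcubicExp` (stmt-NavierStokesRegularity-24077), line `flat_chain` —
# transfer step 2a for S4′ `RegularBlockTransfer`: Tao's (5.17) across a REGULAR ANNULUS, in block currency

Helper toward the registered stub S4′ `stub_regularBlockTransfer` of ns-idea-7 g14's skeleton
`Cruxes/TypeIQuantSubcubicExp/Lines/flat_chain.lean` (v1.2).  For the space-translated field `v = u(·, x₀ + ·)`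
(centre `0`) with a regular annulus `{R < |x| < Λ₁R}` on the level window `[t₁ − s/32, t₁]`
(`‖Dʲv‖ ≤ Cg s^{-(j+1)/2}`, `j ≤ 2` — the content of `RegularBlock Cg Λ₁`), this file runs the tree's PROVED
(5.17) `IsClassicalNSSolutionOn.vorticity_annulus_lower_bound` on the inner annulus `R″ := 2R`, `Λ″ := Λ₁/4` (a closed
annulus inside the open regular one) with Tao's slab length `T₅ := s/C₅`, `C₅ := 32(1+‖curlCLM‖)²Cg²` (so that the
regular bounds are Tao's normalised (5.10)); the (5.18) arrow (`…velocity_cube_mass_of_vorticity_mass`) and the vorticity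
gradient bound `Ω₁` it needs follow in `…FlatChainTransferCube`:

* `annulus_vorticity_mass` — for `Cg ≥ 1` there are constants `Λmin ≥ 16`, `C₅ ≥ 32`, `K ≥ 1` such that for
  `Λ₁ ≥ Λmin`, `0 < s ≤ R²`, a time-integrated annular enstrophy `ζ ≤ ∫_{t₁−T₅/(4·10¹²)}^{t₁}∫_{200R<|x|<800R}‖ω‖²`
  with `√T₅·exp(−Λ₁R²C₅/(8s)) ≤ ζ` yields the final-time annular vorticity mass
  `ζ(C₅/s)exp(−KΛ₁²R²C₅/(4s)) ≤ ∫_{4R ≤ |x| ≤ Λ₁R/4} ‖ω(t₁)‖²` (the annulus written as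
  `closedBall 0 (Λ₁/4·(2R)/2) ∖ ball 0 (2(2R))`, the input shape of (5.18));
* `annulus_vorticity_gradient_le` — on the same closed annulus `‖∇ω(t₁)‖ ≤ (‖curlCLM‖+1)Cg s^{-3/2}` (the `Ω₁` of (5.18)).

HONEST FRAMING: bookkeeping around a PROVED tree theorem about HYPOTHETICAL classical solutions; part of one registered
stub (S4′, size L); nothing here bears on the truth of ⟨24077⟩, W7 or Navier–Stokes regularity (OPEN / not proved).
pub-ns-dss typer (g39), `--supports stmt-NavierStokesRegularity-24077`.
-/

set_option linter.dupNamespace false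

noncomputable section

open MeasureTheory Set Function Metric Filter Topology
open scoped ENNReal NNReal
open Literature.Analysis Literature.Analysis.FluidPDE

namespace Summit.NavierStokesRegularity.NavierStokesRegularity.Cruxes.TypeIQuantSubcubicExp.FlatChain

/-- `s^{-1/2} = (√s)⁻¹`, `s^{-1} = s⁻¹`, `s^{-3/2} = (s√s)⁻¹` for `s > 0`, in the exponent shapes
`-(((j:ℝ)+1)/2)`, `j = 0, 1, 2`. -/
theorem rpow_level_exponents {s : ℝ} (hs : 0 < s) :
    s ^ (-((((0 : ℕ) : ℝ) + 1) / 2)) = (Real.sqrt s)⁻¹ ∧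
      s ^ (-((((1 : ℕ) : ℝ) + 1) / 2)) = s⁻¹ ∧
        s ^ (-((((2 : ℕ) : ℝ) + 1) / 2)) = (s * Real.sqrt s)⁻¹ := by
  refine ⟨?_, ?_, ?_⟩
  · rw [Real.rpow_neg hs.le, Real.sqrt_eq_rpow]; norm_num
  · rw [← Real.rpow_neg_one]; norm_num
  · rw [Real.rpow_neg hs.le, Real.sqrt_eq_rpow, ← Real.rpow_one_add' hs.le (by norm_num)]; norm_num

/-- **Tao's (5.17) across a regular annulus, block currency** (see the module docstring).
[Tao2021QuantitativeNS Thm. 5.1 proof pp. 38–40 (5.8)–(5.17), via the tree's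
`IsClassicalNSSolutionOn.vorticity_annulus_lower_bound`] -/
theorem annulus_vorticity_mass (Cg : ℝ) (hCg : 1 ≤ Cg) :
    ∃ Λmin C₅ K : ℝ, 16 ≤ Λmin ∧ 32 ≤ C₅ ∧ 1 ≤ K ∧
      ∀ ⦃Λ₁ s t₁ R ζ : ℝ⦄ ⦃v : ℝ → EuclideanSpace ℝ (Fin 3) → EuclideanSpace ℝ (Fin 3)⦄
        ⦃q : ℝ → EuclideanSpace ℝ (Fin 3) → ℝ⦄,
        Λmin ≤ Λ₁ → 0 < s → 0 < R → s ≤ R ^ 2 →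
        IsClassicalNSSolutionOn (Icc (t₁ - s / 32) t₁) 1 0 v q →
        (∀ t ∈ Icc (t₁ - s / 32) t₁, ∀ x : EuclideanSpace ℝ (Fin 3), R < ‖x‖ → ‖x‖ < Λ₁ * R →
          ∀ j : ℕ, j ≤ 2 → ‖iteratedFDeriv ℝ j (v t) x‖ ≤ Cg * s ^ (-(((j : ℝ) + 1) / 2))) →
        Real.sqrt (s / C₅) * Real.exp (-(Λ₁ * R ^ 2 * C₅ / (8 * s))) ≤ ζ →
        ζ ≤ ∫ t in (t₁ - s / C₅ / 10 ^ 12 / 4)..t₁,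
          ∫ x in ball (0 : EuclideanSpace ℝ (Fin 3)) (800 * R) \ closedBall 0 (200 * R),
            ‖vorticity v t x‖ ^ 2 →
        ζ * (C₅ / s) * Real.exp (-(K * Λ₁ ^ 2 * R ^ 2 * C₅ / (4 * s))) ≤
          ∫ x in closedBall (0 : EuclideanSpace ℝ (Fin 3)) (Λ₁ / 4 * (2 * R) / 2) \ ball 0 (2 * (2 * R)),
            ‖vorticity v t₁ x‖ ^ 2 := by
  obtain ⟨Λ₀, K, hΛ₀, hK, h517⟩ := IsClassicalNSSolutionOn.vorticity_annulus_lower_bound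
  set κ : ℝ := ‖curlCLM‖ with hκ
  have hκ0 : 0 ≤ κ := by rw [hκ]; exact norm_nonneg curlCLM
  set C₅ : ℝ := 32 * (1 + κ) ^ 2 * Cg ^ 2 with hC₅
  have hCg0 : 0 < Cg := by linarith
  have h1κ : 1 ≤ (1 + κ) ^ 2 := one_le_pow₀ (by linarith)
  have hCg2 : 1 ≤ Cg ^ 2 := one_le_pow₀ hCg
  have hC₅32 : 32 ≤ C₅ := by
    have h1 : (1 : ℝ) * 1 ≤ (1 + κ) ^ 2 * Cg ^ 2 := mul_le_mul h1κ hCg2 zero_le_one (by positivity)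
    have h2 : C₅ = 32 * ((1 + κ) ^ 2 * Cg ^ 2) := by rw [hC₅]; ring
    rw [h2]; linarith
  have hC₅pos : 0 < C₅ := by linarith
  refine ⟨max (4 * Λ₀) 16, C₅, K, le_max_right _ _, hC₅32, hK, ?_⟩
  intro Λ₁ s t₁ R ζ v q hΛ₁ hs hR hsR hcl hreg hζ h57
  -- ### constants and the slab `[t₁ − T₅, t₁]`, `T₅ = s/C₅`
  have hΛ₁16 : 16 ≤ Λ₁ := le_trans (le_max_right _ _) hΛ₁
  have hΛ₁Λ₀ : Λ₀ ≤ Λ₁ / 4 := by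
    have := le_trans (le_max_left _ _) hΛ₁; linarith
  have hΛ''4 : 4 ≤ Λ₁ / 4 := by linarith
  set T₅ : ℝ := s / C₅ with hT₅
  have hT₅pos : 0 < T₅ := div_pos hs hC₅pos
  have hT₅s : T₅ ≤ s / 32 := by
    rw [hT₅]; exact div_le_div_of_nonneg_left hs.le (by norm_num) hC₅32
  have hT₅s' : T₅ ≤ s := hT₅s.trans (by linarith)
  have hsub : Icc (t₁ - T₅) t₁ ⊆ Icc (t₁ - s / 32) t₁ := Icc_subset_Icc (by linarith) le_rfl
  have hcl' : IsClassicalNSSolutionOn (Icc (t₁ - T₅) t₁) 1 0 v q :=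
    hcl.mono hsub (uniqueDiffOn_Icc (by linarith))
  have hss : 0 < Real.sqrt s := Real.sqrt_pos.2 hs
  have hsT₅ : 0 < Real.sqrt T₅ := Real.sqrt_pos.2 hT₅pos
  -- `T₅ ≤ R″²`, `R″ = 2R`
  have hR'' : 0 < 2 * R := by linarith
  have hT₅R : T₅ ≤ (2 * R) ^ 2 := by
    have h4 : R ^ 2 ≤ (2 * R) ^ 2 := by
      rw [mul_pow]; have := sq_nonneg R; linarith
    exact hT₅s'.trans (hsR.trans h4)
  -- the exponents
  obtain ⟨e0, e1, e2⟩ := rpow_level_exponents hs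
  -- ### the normalised bounds (5.10) on the closed annulus `2R ≤ |x| ≤ Λ₁R/2`
  have hsqrtT₅ : Real.sqrt T₅ = Real.sqrt s / Real.sqrt C₅ := by rw [hT₅, Real.sqrt_div hs.le]
  have hsC₅ : 1 ≤ Real.sqrt C₅ := by
    rw [show (1 : ℝ) = Real.sqrt 1 from Real.sqrt_one.symm]
    exact Real.sqrt_le_sqrt (by linarith)
  have hsC₅' : (1 + κ) * Cg ≤ Real.sqrt C₅ := by
    rw [hC₅, show 32 * (1 + κ) ^ 2 * Cg ^ 2 = ((1 + κ) * Cg) ^ 2 * 32 by ring,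
      Real.sqrt_mul (sq_nonneg _), Real.sqrt_sq (by positivity)]
    have h32 : (1 : ℝ) ≤ Real.sqrt 32 := by
      rw [show (1 : ℝ) = Real.sqrt 1 from Real.sqrt_one.symm]
      exact Real.sqrt_le_sqrt (by norm_num)
    have h0 : 0 ≤ (1 + κ) * Cg := by positivity
    exact le_mul_of_one_le_right h0 h32
  have hCgC₅ : (1 + κ) * Cg ≤ C₅ := by
    have : Real.sqrt C₅ ≤ C₅ := by
      calc Real.sqrt C₅ = Real.sqrt C₅ * 1 := (mul_one _).symm
        _ ≤ Real.sqrt C₅ * Real.sqrt C₅ := mul_le_mul_of_nonneg_left hsC₅ (Real.sqrt_nonneg _)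
        _ = C₅ := Real.mul_self_sqrt hC₅pos.le
    exact hsC₅'.trans this
  have hCgκ : Cg ≤ (1 + κ) * Cg := le_mul_of_one_le_left hCg0.le (by linarith)
  have hκCg : κ * Cg ≤ (1 + κ) * Cg := mul_le_mul_of_nonneg_right (by linarith) hCg0.le
  have h510 : ∀ t ∈ Icc (t₁ - T₅) t₁, ∀ x : EuclideanSpace ℝ (Fin 3), 2 * R ≤ ‖x‖ → ‖x‖ ≤ Λ₁ / 4 * (2 * R) →
      ‖v t x‖ ≤ (Real.sqrt T₅)⁻¹ ∧ ‖fderiv ℝ (v t) x‖ ≤ T₅⁻¹ ∧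
        ‖vorticity v t x‖ ≤ T₅⁻¹ ∧ ‖fderiv ℝ (vorticity v t) x‖ ≤ T₅⁻¹ * (Real.sqrt T₅)⁻¹ := by
    intro t ht x hx1 hx2
    have ht' : t ∈ Icc (t₁ - s / 32) t₁ := hsub ht
    have hxR : R < ‖x‖ := by linarith
    have hxΛ : ‖x‖ < Λ₁ * R := by
      have h1 : 2 * R ≤ Λ₁ / 4 * (2 * R) := hx1.trans hx2
      have h2 : Λ₁ / 4 * (2 * R) = (Λ₁ * R) / 2 := by ring
      rw [h2] at h1 hx2
      linarith
    have hj0 := hreg t ht' x hxR hxΛ 0 (by norm_num)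
    have hj1 := hreg t ht' x hxR hxΛ 1 (by norm_num)
    have hj2 := hreg t ht' x hxR hxΛ 2 le_rfl
    rw [e0, norm_iteratedFDeriv_zero] at hj0
    rw [e1, norm_iteratedFDeriv_one] at hj1
    rw [e2] at hj2
    have hv2 : ContDiff ℝ 2 (v t) := (hcl.contDiff_velocity ht').of_le (by norm_cast)
    have hω : ‖vorticity v t x‖ ≤ κ * ‖fderiv ℝ (v t) x‖ := by
      rw [vorticity_apply]; exact norm_curl_le (v t) x
    have hDω : ‖fderiv ℝ (vorticity v t) x‖ ≤ κ * ‖iteratedFDeriv ℝ 2 (v t) x‖ := by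
      rw [vorticity_apply]; exact norm_fderiv_curl_le hv2 x
    -- the four target values in terms of `s`
    have hT₅inv : T₅⁻¹ = C₅ * s⁻¹ := by rw [hT₅, inv_div, div_eq_mul_inv]
    have hsqinv : (Real.sqrt T₅)⁻¹ = Real.sqrt C₅ * (Real.sqrt s)⁻¹ := by
      rw [hsqrtT₅, inv_div, div_eq_mul_inv]
    refine ⟨?_, ?_, ?_, ?_⟩
    · rw [hsqinv]
      calc ‖v t x‖ ≤ Cg * (Real.sqrt s)⁻¹ := hj0
        _ ≤ Real.sqrt C₅ * (Real.sqrt s)⁻¹ :=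
            mul_le_mul_of_nonneg_right (hCgκ.trans hsC₅') (inv_nonneg.2 hss.le)
    · rw [hT₅inv]
      calc ‖fderiv ℝ (v t) x‖ ≤ Cg * s⁻¹ := hj1
        _ ≤ C₅ * s⁻¹ := mul_le_mul_of_nonneg_right (hCgκ.trans hCgC₅) (inv_nonneg.2 hs.le)
    · rw [hT₅inv]
      calc ‖vorticity v t x‖ ≤ κ * ‖fderiv ℝ (v t) x‖ := hω
        _ ≤ κ * (Cg * s⁻¹) := mul_le_mul_of_nonneg_left hj1 hκ0
        _ = κ * Cg * s⁻¹ := by ring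
        _ ≤ C₅ * s⁻¹ := mul_le_mul_of_nonneg_right (hκCg.trans hCgC₅) (inv_nonneg.2 hs.le)
    · rw [hT₅inv, hsqinv]
      calc ‖fderiv ℝ (vorticity v t) x‖ ≤ κ * ‖iteratedFDeriv ℝ 2 (v t) x‖ := hDω
        _ ≤ κ * (Cg * (s * Real.sqrt s)⁻¹) := mul_le_mul_of_nonneg_left hj2 hκ0
        _ = κ * Cg * 1 * (s⁻¹ * (Real.sqrt s)⁻¹) := by rw [mul_inv]; ring
        _ ≤ C₅ * Real.sqrt C₅ * (s⁻¹ * (Real.sqrt s)⁻¹) := by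
            refine mul_le_mul_of_nonneg_right ?_ (by positivity)
            exact mul_le_mul (hκCg.trans hCgC₅) hsC₅ zero_le_one hC₅pos.le
        _ = C₅ * s⁻¹ * (Real.sqrt C₅ * (Real.sqrt s)⁻¹) := by ring
  -- ### the smallness `√T₅ e^{−Λ″R″²/(8T₅)} ≤ ζ`
  have hζ' : Real.sqrt T₅ * Real.exp (-(Λ₁ / 4 * (2 * R) ^ 2 / (8 * T₅))) ≤ ζ := by
    have hexp : Λ₁ / 4 * (2 * R) ^ 2 / (8 * T₅) = Λ₁ * R ^ 2 * C₅ / (8 * s) := by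
      rw [hT₅]; field_simp; ring
    rw [hexp, hT₅]
    exact hζ
  -- ### (5.7)-window: `t₁ − T₅/(4·10¹²) = t₁ − s/C₅/10¹²/4`
  have h57' : ζ ≤ ∫ t in (t₁ - T₅ / 10 ^ 12 / 4)..t₁,
      ∫ x in ball (0 : EuclideanSpace ℝ (Fin 3)) (400 * (2 * R)) \ closedBall 0 (100 * (2 * R)),
        ‖vorticity v t x‖ ^ 2 := by
    have h1 : (400 : ℝ) * (2 * R) = 800 * R := by ring
    have h2 : (100 : ℝ) * (2 * R) = 200 * R := by ring
    rw [h1, h2, hT₅]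
    exact h57
  -- ### (5.17)
  have hann := h517 hcl' hT₅pos hΛ₁Λ₀ hR'' hT₅R h510 hζ' h57'
  -- rewrite its left side: `ζ T₅⁻¹ exp(−K Λ″² R″²/T₅) = m`
  set m : ℝ := ζ * (C₅ / s) * Real.exp (-(K * Λ₁ ^ 2 * R ^ 2 * C₅ / (4 * s))) with hm
  have hmeq : ζ * T₅⁻¹ * Real.exp (-(K * (Λ₁ / 4) ^ 2 * (2 * R) ^ 2 / T₅)) = m := by
    have hexp : K * (Λ₁ / 4) ^ 2 * (2 * R) ^ 2 / T₅ = K * Λ₁ ^ 2 * R ^ 2 * C₅ / (4 * s) := by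
      rw [hT₅]; field_simp; ring
    rw [hm, hexp, hT₅, inv_div]
  rw [hmeq] at hann
  exact hann

/-- **The vorticity-gradient bound `Ω₁` on the closed inner annulus** `2R ≤ |x| ≤ Λ₁/4·(2R)` at the final
time, from the regular-annulus bound of order `2`: `‖∇ω(t₁, x)‖ ≤ (‖curlCLM‖+1)·Cg·s^{-3/2}`
(`norm_fderiv_curl_le`).  This is the `hDω` input of the tree's (5.18)
`IsClassicalNSSolutionOn.velocity_cube_mass_of_vorticity_mass`. -/
theorem annulus_vorticity_gradient_le {Cg Λ₁ s t₁ R : ℝ}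
    {v : ℝ → EuclideanSpace ℝ (Fin 3) → EuclideanSpace ℝ (Fin 3)} {q : ℝ → EuclideanSpace ℝ (Fin 3) → ℝ}
    (hs : 0 < s) (hR : 0 < R)
    (hcl : IsClassicalNSSolutionOn (Icc (t₁ - s / 32) t₁) 1 0 v q)
    (hreg : ∀ t ∈ Icc (t₁ - s / 32) t₁, ∀ x : EuclideanSpace ℝ (Fin 3), R < ‖x‖ → ‖x‖ < Λ₁ * R →
      ∀ j : ℕ, j ≤ 2 → ‖iteratedFDeriv ℝ j (v t) x‖ ≤ Cg * s ^ (-(((j : ℝ) + 1) / 2))) :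
    ∀ x : EuclideanSpace ℝ (Fin 3), 2 * R ≤ ‖x‖ → ‖x‖ ≤ Λ₁ / 4 * (2 * R) →
      ‖fderiv ℝ (vorticity v t₁) x‖ ≤ (‖curlCLM‖ + 1) * Cg * s ^ (-(3 / 2 : ℝ)) := by
  intro x hx1 hx2
  have ht₁mem : t₁ ∈ Icc (t₁ - s / 32) t₁ := ⟨by linarith, le_rfl⟩
  have hxR : R < ‖x‖ := by linarith
  have hxΛ : ‖x‖ < Λ₁ * R := by
    have h1 : 2 * R ≤ Λ₁ / 4 * (2 * R) := hx1.trans hx2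
    have h2 : Λ₁ / 4 * (2 * R) = (Λ₁ * R) / 2 := by ring
    rw [h2] at h1 hx2
    linarith
  have hj2 := hreg t₁ ht₁mem x hxR hxΛ 2 le_rfl
  have hv2 : ContDiff ℝ 2 (v t₁) := (hcl.contDiff_velocity ht₁mem).of_le (by norm_cast)
  have hκ0 : 0 ≤ ‖curlCLM‖ := norm_nonneg curlCLM
  have hj2' : ‖iteratedFDeriv ℝ 2 (v t₁) x‖ ≤ Cg * s ^ (-(3 / 2 : ℝ)) := by
    rw [show (-(3 / 2 : ℝ)) = (-((((2 : ℕ) : ℝ) + 1) / 2)) by norm_num]; exact hj2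
  calc ‖fderiv ℝ (vorticity v t₁) x‖ ≤ ‖curlCLM‖ * ‖iteratedFDeriv ℝ 2 (v t₁) x‖ := by
        rw [vorticity_apply]; exact norm_fderiv_curl_le hv2 x
    _ ≤ ‖curlCLM‖ * (Cg * s ^ (-(3 / 2 : ℝ))) := mul_le_mul_of_nonneg_left hj2' hκ0
    _ ≤ (‖curlCLM‖ + 1) * (Cg * s ^ (-(3 / 2 : ℝ))) :=
        mul_le_mul_of_nonneg_right (by linarith) (le_trans (norm_nonneg _) hj2')
    _ = (‖curlCLM‖ + 1) * Cg * s ^ (-(3 / 2 : ℝ)) := by ring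

end Summit.NavierStokesRegularity.NavierStokesRegularity.Cruxes.TypeIQuantSubcubicExp.FlatChain

end
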